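import Mathlib

/-!
# Bounded holomorphic families of square-integrable functions are holomorphic into `L²`

Support file (complex analysis / measure theory) for the meromorphic continuation of the Eisenstein
series of a general finite volume Fuchsian group (`Literature/NumberTheory/Automorphic/FuchsianEisenstein*`,
towards `Iwaniec2002_eq_12_5` / `Iwaniec2002_thm_12_1`): there the tails `(T_k - ĥ(s)) θ^s` of the
Eisenstein series must be known to be HOLOMORPHIC as `L²(F)`-valued functions of `s`, which is
deduced here from their pointwise holomorphy and uniform boundedness. Everything is PROVED from
Mathlib (Cauchy estimates `Complex.norm_deriv_le_of_forall_mem_sphere_norm_le`, the mean value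
inequality `Convex.norm_image_sub_le_of_norm_deriv_le`, `hasDerivAt_iff_isLittleO_nhds_zero`,
`Lp.norm_le_of_ae_bound`, `aestronglyMeasurable_of_tendsto_ae`); nothing is vendored.

1. (§1) uniform Cauchy estimates for a function `g` holomorphic on an open `U` with `‖g‖ ≤ C`:
   `‖g'(s)‖ ≤ C/r` when `closedBall s r ⊆ U` (`norm_deriv_le_of_bound`), and the **uniform
   second-order Taylor bound** `‖g(s₀ + h) - g(s₀) - h g'(s₀)‖ ≤ (4C/r²)‖h‖²` for `‖h‖ ≤ r/2` when
   `closedBall s₀ (2r) ⊆ U` (`norm_sub_sub_smul_deriv_le`).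
2. (§2) **`differentiableOn_of_bound` / `analyticOnNhd_of_bound`**: on a finite measure space, if
   `F : ℂ → L²(μ)` represents `f(s, ·)` for `s` in an open `U`, each `s ↦ f(s, x)` is holomorphic on
   `U`, each `f(s, ·)` is a.e.-strongly measurable and `|f| ≤ C` on `U × X`, then `F` is holomorphic
   (hence analytic) on `U` — the difference quotients converge in `L²` by the uniform Taylor bound;
   `analyticOnNhd_of_locally_bounded` is the version with locally uniform bounds.

## References
* W. Rudin, *Functional Analysis*, 2nd ed. (1991), Thm 3.31 & Ch. 3 exercises (weakly/strongly
  holomorphic vector-valued functions); here proved directly for `L²`.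
-/

noncomputable section

namespace Literature.Analysis.Complex

open MeasureTheory Filter Topology Metric Set Asymptotics
open scoped ENNReal NNReal

/-! ## 1. Uniform Cauchy estimates for a bounded holomorphic family -/

section Cauchy

variable {V : Type*} [NormedAddCommGroup V] [NormedSpace ℂ V] [CompleteSpace V]

omit [CompleteSpace V] in
/-- **Cauchy estimate, first derivative, on an open set**: if `g` is complex differentiable on an open
`U` with `‖g‖ ≤ C` there and `closedBall s r ⊆ U`, `r > 0`, then `‖g'(s)‖ ≤ C / r`. [folklore] -/
theorem norm_deriv_le_of_bound {g : ℂ → V} {U : Set ℂ} (hg : DifferentiableOn ℂ g U)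
    {C : ℝ} (hC : ∀ z ∈ U, ‖g z‖ ≤ C) {s : ℂ} {r : ℝ} (hr : 0 < r) (hsub : closedBall s r ⊆ U) :
    ‖deriv g s‖ ≤ C / r := by
  refine Complex.norm_deriv_le_of_forall_mem_sphere_norm_le hr ?_ fun z hz => hC z (hsub (sphere_subset_closedBall hz))
  exact hg.diffContOnCl_ball hsub

/-- **Uniform second-order Taylor bound**: with `‖g‖ ≤ C` on the open `U ⊇ closedBall s₀ (2r)`,
`‖g(s₀ + h) - g(s₀) - h g'(s₀)‖ ≤ (4C/r²) ‖h‖²` for `‖h‖ ≤ r/2`. [folklore] -/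
theorem norm_sub_sub_smul_deriv_le {g : ℂ → V} {U : Set ℂ} (hU : IsOpen U) (hg : DifferentiableOn ℂ g U)
    {C : ℝ} (hC : ∀ z ∈ U, ‖g z‖ ≤ C) {s₀ : ℂ} {r : ℝ} (hr : 0 < r) (hsub : closedBall s₀ (2 * r) ⊆ U)
    {h : ℂ} (hh : ‖h‖ ≤ r / 2) :
    ‖g (s₀ + h) - g s₀ - h • deriv g s₀‖ ≤ 4 * C / r ^ 2 * ‖h‖ ^ 2 := by
  have hC0 : 0 ≤ C := (norm_nonneg _).trans (hC s₀ (hsub (mem_closedBall_self (by linarith))))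
  -- first derivative bound on `closedBall s₀ (3r/2)` (discs of radius `r/2` stay in `closedBall s₀ (2r)`)
  have hd1 : ∀ s ∈ closedBall s₀ (3 * r / 2), ‖deriv g s‖ ≤ C / (r / 2) := by
    intro s hs
    refine norm_deriv_le_of_bound hg hC (by linarith) (Subset.trans ?_ hsub)
    intro z hz
    rw [mem_closedBall] at hs hz ⊢
    linarith [dist_triangle z s s₀]
  -- `g'` is differentiable on `U`
  have hg' : DifferentiableOn ℂ (deriv g) U := (hg.analyticOnNhd hU).deriv.differentiableOn
  -- second derivative bound on `closedBall s₀ (r/2)`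
  have hsubU : ball s₀ (3 * r / 2) ⊆ U :=
    Subset.trans ball_subset_closedBall (Subset.trans (closedBall_subset_closedBall (by linarith)) hsub)
  have hd2 : ∀ s ∈ closedBall s₀ (r / 2), ‖deriv (deriv g) s‖ ≤ (C / (r / 2)) / (r / 2) := by
    intro s hs
    refine norm_deriv_le_of_bound (hg'.mono hsubU) (fun z hz => hd1 z (ball_subset_closedBall hz))
      (by linarith) ?_
    intro z hz
    rw [mem_closedBall] at hs hz
    rw [mem_ball]
    linarith [dist_triangle z s s₀]
  set K : ℝ := (C / (r / 2)) / (r / 2) with hKdef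
  have hK : K = 4 * C / r ^ 2 := by rw [hKdef]; field_simp; ring
  have hK0 : 0 ≤ K := by rw [hK]; positivity
  -- the small closed disc `D = closedBall s₀ ‖h‖ ⊆ closedBall s₀ (r/2) ⊆ U`
  have hDsub : closedBall s₀ ‖h‖ ⊆ closedBall s₀ (r / 2) := closedBall_subset_closedBall hh
  have hDU : closedBall s₀ ‖h‖ ⊆ U :=
    Subset.trans hDsub (Subset.trans (closedBall_subset_closedBall (by linarith)) hsub)
  have hmem_h : s₀ + h ∈ closedBall s₀ ‖h‖ := by simp [mem_closedBall, dist_eq_norm]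
  -- mean value for `g'` from `s₀`
  have hmvt1 : ∀ s ∈ closedBall s₀ ‖h‖, ‖deriv g s - deriv g s₀‖ ≤ K * ‖h‖ := by
    intro s hs
    have h1 := (convex_closedBall s₀ ‖h‖).norm_image_sub_le_of_norm_deriv_le (f := deriv g) (C := K)
      (fun x hx => (hg' x (hDU hx)).differentiableAt (hU.mem_nhds (hDU hx)))
      (fun x hx => hd2 x (hDsub hx)) (mem_closedBall_self (norm_nonneg h)) hs
    refine h1.trans ?_
    have : ‖s - s₀‖ ≤ ‖h‖ := by rw [← dist_eq_norm]; exact mem_closedBall.mp hs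
    exact mul_le_mul_of_nonneg_left this hK0
  -- the function `ψ(s) = g(s) - (s - s₀) g'(s₀)` has small derivative on `D`
  set v : V := deriv g s₀ with hv
  set ψ : ℂ → V := fun s => g s - (s - s₀) • v with hψ
  have hψderiv : ∀ x ∈ closedBall s₀ ‖h‖, HasDerivAt ψ (deriv g x - v) x := by
    intro x hx
    have h1 : HasDerivAt g (deriv g x) x := ((hg x (hDU hx)).differentiableAt (hU.mem_nhds (hDU hx))).hasDerivAt
    have h2 : HasDerivAt (fun s : ℂ => (s - s₀) • v) ((1 : ℂ) • v) x := ((hasDerivAt_id x).sub_const s₀).smul_const v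
    rw [one_smul] at h2
    exact h1.sub h2
  have hψd : ∀ x ∈ closedBall s₀ ‖h‖, DifferentiableAt ℂ ψ x := fun x hx => (hψderiv x hx).differentiableAt
  have hψ' : ∀ x ∈ closedBall s₀ ‖h‖, ‖deriv ψ x‖ ≤ K * ‖h‖ := by
    intro x hx
    rw [(hψderiv x hx).deriv]
    exact hmvt1 x hx
  have hmain := (convex_closedBall s₀ ‖h‖).norm_image_sub_le_of_norm_deriv_le hψd hψ'
    (mem_closedBall_self (norm_nonneg h)) hmem_h
  have e : ψ (s₀ + h) - ψ s₀ = g (s₀ + h) - g s₀ - h • deriv g s₀ := by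
    simp only [hψ, hv, sub_self, zero_smul, sub_zero, add_sub_cancel_left]
    abel
  rw [e, add_sub_cancel_left] at hmain
  calc ‖g (s₀ + h) - g s₀ - h • deriv g s₀‖ ≤ K * ‖h‖ * ‖h‖ := hmain
    _ = 4 * C / r ^ 2 * ‖h‖ ^ 2 := by rw [hK]; ring

omit [CompleteSpace V] in
/-- First-derivative bound at the centre, in the form used below: `‖g'(s₀)‖ ≤ C / r`. [folklore] -/
theorem norm_deriv_le_of_bound' {g : ℂ → V} {U : Set ℂ} (hg : DifferentiableOn ℂ g U)
    {C : ℝ} (hC : ∀ z ∈ U, ‖g z‖ ≤ C) {s₀ : ℂ} {r : ℝ} (hr : 0 < r) (hsub : closedBall s₀ (2 * r) ⊆ U) :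
    ‖deriv g s₀‖ ≤ C / r :=
  norm_deriv_le_of_bound hg hC hr (Subset.trans (closedBall_subset_closedBall (by linarith)) hsub)

end Cauchy

/-! ## 2. Square-integrable bounded holomorphic families are holomorphic into `L²` -/

section LpValued

variable {X : Type*} [MeasurableSpace X] {μ : Measure X} [IsFiniteMeasure μ]

/-- **A uniformly bounded family `f(s, ·)` of functions on a finite measure space, holomorphic in
the parameter `s ∈ U` pointwise, defines a holomorphic map `U → L²(μ)`.** Precisely: if
`F : ℂ → L²(μ)` represents `f s` for every `s` in the open set `U`, each `s ↦ f s x` is complex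
differentiable on `U`, each `f s` is a.e.-strongly measurable and `‖f s x‖ ≤ C` on `U × X`, then
`F` is complex differentiable on `U` (uniform Cauchy estimates make the difference quotients converge
in `L²`). [folklore] -/
theorem differentiableOn_of_bound {f : ℂ → X → ℂ} {U : Set ℂ} (hU : IsOpen U)
    (hdiff : ∀ x, DifferentiableOn ℂ (fun s => f s x) U)
    (hmeas : ∀ s ∈ U, AEStronglyMeasurable (f s) μ) {C : ℝ} (hC0 : 0 ≤ C) (hC : ∀ s ∈ U, ∀ x, ‖f s x‖ ≤ C)
    {F : ℂ → Lp ℂ 2 μ} (hF : ∀ s ∈ U, (F s : X → ℂ) =ᵐ[μ] f s) : DifferentiableOn ℂ F U := by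
  intro s₀ hs₀
  -- a disc `closedBall s₀ (2r) ⊆ U`
  obtain ⟨ρ, hρ, hρU⟩ := Metric.isOpen_iff.mp hU s₀ hs₀
  set r : ℝ := ρ / 4 with hr
  have hr0 : 0 < r := by rw [hr]; positivity
  have hsub : closedBall s₀ (2 * r) ⊆ U := by
    refine Subset.trans ?_ hρU
    intro z hz
    rw [mem_closedBall] at hz
    rw [mem_ball]
    linarith
  have hmemU : ∀ {h : ℂ}, ‖h‖ ≤ r / 2 → s₀ + h ∈ U := fun {h} hh =>
    hsub (by rw [mem_closedBall, dist_eq_norm, add_sub_cancel_left]; linarith)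
  -- the derivative, pointwise
  set d : X → ℂ := fun x => deriv (fun s => f s x) s₀ with hd
  have hdx : ∀ x, HasDerivAt (fun s => f s x) (d x) s₀ := fun x =>
    ((hdiff x s₀ hs₀).differentiableAt (hU.mem_nhds hs₀)).hasDerivAt
  have hdbound : ∀ x, ‖d x‖ ≤ C / r := fun x =>
    norm_deriv_le_of_bound' (hdiff x) (fun z hz => hC z hz x) hr0 hsub
  -- measurability of `d` as a pointwise limit of difference quotients
  set tseq : ℕ → ℝ := fun n => (r / 2) / ((n : ℝ) + 1) with htseq
  have htpos : ∀ n, 0 < tseq n := fun n => by rw [htseq]; positivity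
  have htle : ∀ n, tseq n ≤ r / 2 := fun n => by
    rw [htseq]
    exact div_le_self (by linarith) (by linarith [(Nat.cast_nonneg n : (0 : ℝ) ≤ n)])
  have htend : Tendsto tseq atTop (𝓝 0) := by
    rw [htseq]
    exact tendsto_const_nhds.div_atTop (tendsto_natCast_atTop_atTop.atTop_add tendsto_const_nhds)
  have htend' : Tendsto (fun n => ((tseq n : ℝ) : ℂ)) atTop (𝓝[≠] 0) := by
    rw [tendsto_nhdsWithin_iff]
    refine ⟨?_, Eventually.of_forall fun n => ?_⟩
    · have := (Complex.continuous_ofReal.tendsto 0).comp htend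
      rw [Complex.ofReal_zero] at this
      exact this
    · simp only [mem_compl_iff, mem_singleton_iff, Complex.ofReal_eq_zero]
      exact (htpos n).ne'
  set q : ℕ → X → ℂ := fun n x => ((tseq n : ℝ) : ℂ)⁻¹ • (f (s₀ + (tseq n : ℂ)) x - f s₀ x) with hq
  have hqm : ∀ n, AEStronglyMeasurable (q n) μ := by
    intro n
    have hmem : s₀ + ((tseq n : ℝ) : ℂ) ∈ U := hmemU (by rw [Complex.norm_real, Real.norm_of_nonneg (htpos n).le]; exact htle n)
    have := ((hmeas _ hmem).sub (hmeas s₀ hs₀)).const_smul ((((tseq n : ℝ) : ℂ))⁻¹)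
    exact this
  have hqlim : ∀ᵐ x ∂μ, Tendsto (fun n => q n x) atTop (𝓝 (d x)) := by
    refine Eventually.of_forall fun x => ?_
    have h1 := (hdx x).tendsto_slope_zero
    exact h1.comp htend'
  have hdm : AEStronglyMeasurable d μ := aestronglyMeasurable_of_tendsto_ae atTop hqm hqlim
  have hdmem : MemLp d 2 μ := MemLp.of_bound hdm (C / r) (Eventually.of_forall hdbound)
  set D : Lp ℂ 2 μ := hdmem.toLp d with hD
  -- the second-order bound, pointwise
  have hrem : ∀ {h : ℂ}, ‖h‖ ≤ r / 2 → ∀ x, ‖f (s₀ + h) x - f s₀ x - h • d x‖ ≤ 4 * C / r ^ 2 * ‖h‖ ^ 2 :=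
    fun {h} hh x => norm_sub_sub_smul_deriv_le hU (hdiff x) (fun z hz => hC z hz x) hr0 hsub hh
  -- hence in `L²`
  set Λ : ℝ := (measureUnivNNReal μ : ℝ) ^ (2 : ℝ≥0∞).toReal⁻¹ with hΛ
  have hΛ0 : 0 ≤ Λ := by rw [hΛ]; positivity
  have hnorm : ∀ {h : ℂ}, ‖h‖ ≤ r / 2 → ‖F (s₀ + h) - F s₀ - h • D‖ ≤ Λ * (4 * C / r ^ 2 * ‖h‖ ^ 2) := by
    intro h hh
    have hae : ∀ᵐ x ∂μ, ‖(F (s₀ + h) - F s₀ - h • D) x‖ ≤ 4 * C / r ^ 2 * ‖h‖ ^ 2 := by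
      filter_upwards [Lp.coeFn_sub (F (s₀ + h) - F s₀) (h • D), Lp.coeFn_sub (F (s₀ + h)) (F s₀),
        Lp.coeFn_smul h D, hF _ (hmemU hh), hF s₀ hs₀, hdmem.coeFn_toLp] with x h1 h2 h3 h4 h5 h6
      rw [h1, Pi.sub_apply, h2, Pi.sub_apply, h3, Pi.smul_apply, h4, h5, hD, h6]
      exact hrem hh x
    exact Lp.norm_le_of_ae_bound (by positivity) hae
  -- `HasDerivAt F D s₀`
  have hderiv : HasDerivAt F D s₀ := by
    rw [hasDerivAt_iff_isLittleO_nhds_zero]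
    have hbig : (fun h => F (s₀ + h) - F s₀ - h • D) =O[𝓝 0] fun h : ℂ => ‖h‖ ^ 2 := by
      refine IsBigO.of_bound (Λ * (4 * C / r ^ 2)) ?_
      have hev : ∀ᶠ h : ℂ in 𝓝 0, ‖h‖ ≤ r / 2 := by
        have : Metric.closedBall (0 : ℂ) (r / 2) ∈ 𝓝 (0 : ℂ) := closedBall_mem_nhds 0 (by linarith)
        filter_upwards [this] with h hh
        rwa [mem_closedBall, dist_zero_right] at hh
      filter_upwards [hev] with h hh
      refine (hnorm hh).trans (le_of_eq ?_)
      rw [Real.norm_of_nonneg (by positivity)]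
      ring
    exact hbig.trans_isLittleO (isLittleO_norm_pow_id one_lt_two)
  exact hderiv.differentiableAt.differentiableWithinAt

/-- Analytic form: under the same hypotheses `F` is analytic on a neighbourhood of every point of `U`.
[folklore] -/
theorem analyticOnNhd_of_bound {f : ℂ → X → ℂ} {U : Set ℂ} (hU : IsOpen U)
    (hdiff : ∀ x, DifferentiableOn ℂ (fun s => f s x) U)
    (hmeas : ∀ s ∈ U, AEStronglyMeasurable (f s) μ) {C : ℝ} (hC0 : 0 ≤ C) (hC : ∀ s ∈ U, ∀ x, ‖f s x‖ ≤ C)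
    {F : ℂ → Lp ℂ 2 μ} (hF : ∀ s ∈ U, (F s : X → ℂ) =ᵐ[μ] f s) : AnalyticOnNhd ℂ F U :=
  (differentiableOn_of_bound hU hdiff hmeas hC0 hC hF).analyticOnNhd hU

/-- **Local version**: it suffices that every point of `U` has a neighbourhood in `U` on which the
family is uniformly bounded (e.g. continuous bounds in `s`). [folklore] -/
theorem analyticOnNhd_of_locally_bounded {f : ℂ → X → ℂ} {U : Set ℂ} (hU : IsOpen U)
    (hdiff : ∀ x, DifferentiableOn ℂ (fun s => f s x) U)
    (hmeas : ∀ s ∈ U, AEStronglyMeasurable (f s) μ)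
    (hloc : ∀ s₀ ∈ U, ∃ V ∈ 𝓝 s₀, ∃ C : ℝ, ∀ s ∈ V, ∀ x, ‖f s x‖ ≤ C)
    {F : ℂ → Lp ℂ 2 μ} (hF : ∀ s ∈ U, (F s : X → ℂ) =ᵐ[μ] f s) : AnalyticOnNhd ℂ F U := by
  intro s₀ hs₀
  obtain ⟨V, hV, C, hC⟩ := hloc s₀ hs₀
  obtain ⟨W, hWsub, hWopen, hW0⟩ := _root_.mem_nhds_iff.mp (inter_mem hV (hU.mem_nhds hs₀))
  have hWU : W ⊆ U := fun z hz => (hWsub hz).2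
  have hWV : W ⊆ V := fun z hz => (hWsub hz).1
  have hC0 : 0 ≤ max C 0 := le_max_right _ _
  have h := analyticOnNhd_of_bound (μ := μ) hWopen (fun x => (hdiff x).mono hWU) (fun s hs => hmeas s (hWU hs)) hC0
    (fun s hs x => (hC s (hWV hs) x).trans (le_max_left _ _)) (F := F) (fun s hs => hF s (hWU hs))
  exact h s₀ hW0

end LpValued

end Literature.Analysis.Complex
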